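import Summits.NavierStokesRegularity.NavierStokesRegularity.Theorems.SqueezeCycleRecurrentLiouvilleDecayedReduction
import HarnessLib

/-!
# Crux `RecurrentLiouville` (stmt-NavierStokesRegularity-1589), line `Sketch` — helper for stub
# `stub_satHullNoSatellites` (S1a): the converse arrow "apex ⇒ satellite-free hull"

The line's first step S1 (∃-form satellite exclusion: a uniformly recurrent, origin-singular
member of the Albritton–Barker class yields one in the APEX class
`‖w(t, x)‖ ≤ C'/(‖x‖ + √(−t))`, KNSS 2009 (1.6)) was reshaped by the lead into
S1a `stub_satHullNoSatellites` (OPEN, structural: some recurrent singular class profile has a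
SATELLITE-FREE scaling hull — no `L³_loc`-limit `v` of its rescalings `u_{c_n}` has a final-time
singular point `(0, x)`, `x ≠ 0`) followed by S1b `stub_satApexOfNoSatellites` (a satellite-free
hull upgrades the rate `C/√(−t)` to the apex bound).  This file proves the CONVERSE arrow, so
that the reshape loses nothing (S1 ⟹ S1a, hence S1 ⟺ S1a given S1b):

* `satHNA_not_isBackwardSingularPoint_of_ae_apex` — a field with the apex bound ALMOST
  EVERYWHERE on `ℝ₋ × ℝ³` has no backward singular point `(0, x)`, `x ≠ 0`: on the backward ball
  `Q((0, x), ‖x‖/2)` every point `(s, y)` has `‖y‖ ≥ ‖x‖/2`, so `‖v‖ ≤ 2|C|/‖x‖` a.e. there and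
  the ESSENTIAL sup is finite (the a.e. twin of `not_isBackwardSingularPoint_of_hasTypeIDecay`
  of `Literature/Analysis/FluidPDE/ParasiticSlabFlow.lean`).
* `satHNA_aestronglyMeasurable_nsRescale` — rescalings of a field measurable on `ℝ₋ × ℝ³` are
  measurable there (the parabolic dilation is quasi-measure-preserving and maps the half-space
  onto itself).
* `satHNA_ae_apex_of_tendsto` — if `u` has the apex bound with constant `C` and `u_{c_n} → v`
  in `L³(Q(0, R))` for every `R > 0` (`c_n > 0`), then `v` has the apex bound with the SAME `C`
  a.e. on `ℝ₋ × ℝ³`: the bound is scale invariant (`HasTypeIDecay.nsRescale`) and closed under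
  `L³_loc` limits a.e. (`satDR_ae_apex_of_tendsto_eLpNorm`).
* `satHull_noSatellites_of_hasTypeIDecay` — consequently NO member of the scaling hull of an
  apex-class field has a satellite (measurability form); `satHull_noSatellites_of_apexClass`
  (class form: measurability read off the weak gradients).
* `satHullNoSatellites_of_apexProfile` — ∃-form: a uniformly recurrent, origin-singular
  apex-class profile is a witness of the conclusion of `stub_satHullNoSatellites` (rate constant
  = apex constant).
* `stub_satHullNoSatellitesOfApexTools` — the registered tools stub (conjunction of the class
  form and the ∃-form).

## References

* G. Koch, N. Nadirashvili, G. Seregin, V. Šverák, *Liouville theorems for the Navier–Stokes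
  equations and applications*, Acta Math. 203 (2009) 83–105, (1.6) and §1 (scale invariance of
  (1.6)). [KNSS2009]
* D. Albritton, T. Barker, J. Math. Fluid Mech. 21 (2019), no. 43 = arXiv:1811.00502, §1
  (singular points: `v ∉ L^∞(Q(z, r))` for every `r > 0`). [AlbrittonBarker2019]
-/

noncomputable section

-- the sub-problem namespace repeats the summit name (D-0017 layout `Summit.<S>.<P>.Theorems`)
set_option linter.dupNamespace false

namespace Summit.NavierStokesRegularity.NavierStokesRegularity.Theorems

open MeasureTheory Set Function Filter Topology TopologicalSpace Metric
open Literature.Analysis.FluidPDE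
open scoped NNReal ENNReal

/-! ### An a.e. apex bound excludes final-time singular points off the origin -/

/-- The backward parabolic balls `Q((0, x), r) = (-r², 0) × B_r(x)` centred on the final slice
lie in the half-space `ℝ₋ × ℝ³`. [folklore] -/
theorem satHNA_parabolicCylinder_final_subset_lowerHalf (r : ℝ) (x : EuclideanSpace ℝ (Fin 3)) :
    parabolicCylinder r ((0 : ℝ), x) ⊆ Iio (0 : ℝ) ×ˢ (univ : Set (EuclideanSpace ℝ (Fin 3))) := by
  intro w hw
  rw [mem_parabolicCylinder] at hw
  exact ⟨hw.1.2, mem_univ _⟩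

/-- **An a.e. apex bound excludes satellites.**  If `‖v(s, y)‖ ≤ C/(‖y‖ + √(−s))` for a.e.
`(s, y) ∈ ℝ₋ × ℝ³` (KNSS 2009, (1.6), almost everywhere), then no final-time point `(0, x)`,
`x ≠ 0`, is backward singular in Albritton–Barker's (essential) sense: on `Q((0, x), ‖x‖/2)`
one has `‖y‖ ≥ ‖x‖/2`, so `‖v‖ ≤ 2|C|/‖x‖` a.e. there and `‖v‖_{L^∞(Q((0, x), ‖x‖/2))} < ∞`.
The final-time singular set of an apex-class field sits in `{0}`. [cite: KNSS2009, (1.6)] -/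
theorem satHNA_not_isBackwardSingularPoint_of_ae_apex
    {v : ℝ → EuclideanSpace ℝ (Fin 3) → EuclideanSpace ℝ (Fin 3)} {C : ℝ}
    (hapex : ∀ᵐ z ∂(volume.restrict (Iio (0 : ℝ) ×ˢ (univ : Set (EuclideanSpace ℝ (Fin 3))))),
      ‖v z.1 z.2‖ ≤ C / (‖z.2‖ + Real.sqrt (-z.1)))
    {x : EuclideanSpace ℝ (Fin 3)} (hx : x ≠ 0) :
    ¬ IsBackwardSingularPoint v ((0 : ℝ), x) := by
  -- adapted from ParasiticSlabFlow.lean (`not_isBackwardSingularPoint_of_hasTypeIDecay`)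
  intro hs
  set r : ℝ := ‖x‖ / 2 with hr
  have hx0 : 0 < ‖x‖ := norm_pos_iff.2 hx
  have hrpos : 0 < r := by positivity
  have hbound : ∀ᵐ z ∂(volume.restrict (parabolicCylinder r ((0 : ℝ), x))),
      ‖uncurry v z‖ ≤ |C| / r := by
    filter_upwards [ae_restrict_of_ae_restrict_of_subset
        (satHNA_parabolicCylinder_final_subset_lowerHalf r x) hapex,
      ae_restrict_mem (isOpen_parabolicCylinder r _).measurableSet] with z hz hzQ
    rw [mem_parabolicCylinder] at hzQ
    obtain ⟨⟨-, ht2⟩, hdist⟩ := hzQ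
    have hxr : r ≤ ‖z.2‖ := by
      have hd : ‖z.2 - x‖ < r := by rwa [← dist_eq_norm]
      have h1 : ‖x‖ ≤ ‖z.2‖ + ‖z.2 - x‖ :=
        calc ‖x‖ = ‖z.2 - (z.2 - x)‖ := by rw [sub_sub_cancel]
          _ ≤ ‖z.2‖ + ‖z.2 - x‖ := norm_sub_le _ _
      linarith
    have hden : r ≤ ‖z.2‖ + Real.sqrt (-z.1) := by linarith [Real.sqrt_nonneg (-z.1)]
    calc ‖uncurry v z‖ = ‖v z.1 z.2‖ := rfl
      _ ≤ C / (‖z.2‖ + Real.sqrt (-z.1)) := hz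
      _ ≤ |C| / (‖z.2‖ + Real.sqrt (-z.1)) :=
          div_le_div_of_nonneg_right (le_abs_self C) (hrpos.le.trans hden)
      _ ≤ |C| / r := div_le_div_of_nonneg_left (abs_nonneg C) hrpos hden
  have hlt : eLpNorm (uncurry v) ∞ (volume.restrict (parabolicCylinder r ((0 : ℝ), x))) < ⊤ := by
    rw [eLpNorm_exponent_top]
    exact eLpNormEssSup_lt_top_of_ae_bound hbound
  exact hlt.ne (hs r hrpos)

/-! ### The apex bound survives in the scaling hull -/

/-- **Rescalings stay measurable on the half-space.**  If `u` is a.e.-strongly measurable on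
`ℝ₋ × ℝ³`, so is `u_a = a u(a² ·, a ·)` for `a > 0`: the parabolic dilation
`(s, y) ↦ (a² s, a y)` is quasi-measure-preserving and maps `ℝ₋ × ℝ³` onto itself. [folklore] -/
theorem satHNA_aestronglyMeasurable_nsRescale
    {u : ℝ → EuclideanSpace ℝ (Fin 3) → EuclideanSpace ℝ (Fin 3)}
    (hum : AEStronglyMeasurable (uncurry u)
      (volume.restrict (Iio (0 : ℝ) ×ˢ (univ : Set (EuclideanSpace ℝ (Fin 3))))))
    {a : ℝ} (ha : 0 < a) :
    AEStronglyMeasurable (uncurry (nsRescale a u))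
      (volume.restrict (Iio (0 : ℝ) ×ˢ (univ : Set (EuclideanSpace ℝ (Fin 3))))) := by
  -- adapted from ChaeWolfLocalLeray.lean (`aestronglyMeasurable_uncurry_nsRescale`, upper half-space)
  have h1 : uncurry (nsRescale a u) =
      fun z => a • (uncurry u ∘ stAffine (a ^ 2) a 0 (0 : EuclideanSpace ℝ (Fin 3))) z := by
    funext z
    obtain ⟨t, y⟩ := z
    simp [nsRescale_apply, stAffine_apply]
  have hq : Measure.QuasiMeasurePreserving (stAffine (a ^ 2) a 0 (0 : EuclideanSpace ℝ (Fin 3)))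
      (volume.restrict (Iio (0 : ℝ) ×ˢ (univ : Set (EuclideanSpace ℝ (Fin 3)))))
      (volume.restrict (Iio (0 : ℝ) ×ˢ (univ : Set (EuclideanSpace ℝ (Fin 3))))) := by
    refine ⟨measurable_stAffine _ _ _ _, ?_⟩
    have e := map_stAffine_volume_restrict_preimage (E := EuclideanSpace ℝ (Fin 3))
      (pow_pos ha 2) ha 0 0 (Iio (0 : ℝ) ×ˢ (univ : Set (EuclideanSpace ℝ (Fin 3))))
    rw [stAffine_preimage_lowerHalf ha] at e
    rw [e]
    exact Measure.smul_absolutelyContinuous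
  rw [h1]
  exact (hum.comp_quasiMeasurePreserving hq).const_smul a

/-- **The apex bound survives in the scaling hull, almost everywhere.**  If `u` has the apex
bound `‖u(t, x)‖ ≤ C/(‖x‖ + √(−t))` and rescalings `u_{c_n}` (`c_n > 0`) converge to `v` in
`L³(Q(0, R))` for every `R > 0`, then `‖v(s, y)‖ ≤ C/(‖y‖ + √(−s))` for a.e.
`(s, y) ∈ ℝ₋ × ℝ³`: every `u_{c_n}` obeys the bound with the same `C` (scale invariance of
(1.6), `HasTypeIDecay.nsRescale`) and the bound passes to `L³_loc` limits almost everywhere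
(`satDR_ae_apex_of_tendsto_eLpNorm`, on the exhausting balls `Q(0, n+1)`).
[cite: KNSS2009, (1.6)] -/
theorem satHNA_ae_apex_of_tendsto
    {u v : ℝ → EuclideanSpace ℝ (Fin 3) → EuclideanSpace ℝ (Fin 3)} {C : ℝ}
    (hdec : HasTypeIDecay C u)
    (hum : AEStronglyMeasurable (uncurry u)
      (volume.restrict (Iio (0 : ℝ) ×ˢ (univ : Set (EuclideanSpace ℝ (Fin 3))))))
    {c : ℕ → ℝ} (hc : ∀ n, 0 < c n)
    (hvm : AEStronglyMeasurable (uncurry v)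
      (volume.restrict (Iio (0 : ℝ) ×ˢ (univ : Set (EuclideanSpace ℝ (Fin 3))))))
    (hconv : ∀ R : ℝ, 0 < R → Tendsto (fun n => eLpNorm (uncurry (nsRescale (c n) u) - uncurry v) 3
      (volume.restrict (parabolicCylinder R (0 : ℝ × EuclideanSpace ℝ (Fin 3))))) atTop (𝓝 0)) :
    ∀ᵐ z ∂(volume.restrict (Iio (0 : ℝ) ×ˢ (univ : Set (EuclideanSpace ℝ (Fin 3))))),
      ‖v z.1 z.2‖ ≤ C / (‖z.2‖ + Real.sqrt (-z.1)) :=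
  satDR_ae_apex_of_tendsto_eLpNorm (v := fun j => nsRescale (c j) u) (w := v)
    (fun j => hdec.nsRescale (hc j))
    (fun _ j => (satHNA_aestronglyMeasurable_nsRescale hum (hc j)).mono_measure
      (Measure.restrict_mono (parabolicCylinder_origin_subset_slab _) le_rfl))
    (fun _ => hvm.mono_measure (Measure.restrict_mono (parabolicCylinder_origin_subset_slab _) le_rfl))
    (fun n => hconv _ (by positivity))

/-! ### No satellites in the hull of an apex-class profile -/

/-- **No satellites in the scaling hull of an apex-class field** (measurability form).  If `u`
has the apex bound `‖u(t, x)‖ ≤ C/(‖x‖ + √(−t))` and rescalings `u_{c_n}`, `c_n > 0`, converge to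
`v` in `L³(Q(0, R))` for every `R > 0` (`u`, `v` measurable on `ℝ₋ × ℝ³`), then `v` has no
backward singular point `(0, x)` with `x ≠ 0`.  This is the converse direction of the line's
reshape S1 = S1b ∘ S1a (apex ⇒ satellite-free hull). [cite: KNSS2009, (1.6)] -/
theorem satHull_noSatellites_of_hasTypeIDecay
    {u v : ℝ → EuclideanSpace ℝ (Fin 3) → EuclideanSpace ℝ (Fin 3)} {C : ℝ}
    (hdec : HasTypeIDecay C u)
    (hum : AEStronglyMeasurable (uncurry u)
      (volume.restrict (Iio (0 : ℝ) ×ˢ (univ : Set (EuclideanSpace ℝ (Fin 3))))))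
    {c : ℕ → ℝ} (hc : ∀ n, 0 < c n)
    (hvm : AEStronglyMeasurable (uncurry v)
      (volume.restrict (Iio (0 : ℝ) ×ˢ (univ : Set (EuclideanSpace ℝ (Fin 3))))))
    (hconv : ∀ R : ℝ, 0 < R → Tendsto (fun n => eLpNorm (uncurry (nsRescale (c n) u) - uncurry v) 3
      (volume.restrict (parabolicCylinder R (0 : ℝ × EuclideanSpace ℝ (Fin 3))))) atTop (𝓝 0))
    {x : EuclideanSpace ℝ (Fin 3)} (hx : x ≠ 0) :
    ¬ IsBackwardSingularPoint v ((0 : ℝ), x) :=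
  satHNA_not_isBackwardSingularPoint_of_ae_apex (satHNA_ae_apex_of_tendsto hdec hum hc hvm hconv) hx

/-- **No satellites in the scaling hull of an apex-class profile** (class form).  For fields
`u`, `v` with weak spatial gradients on the slab `ℝ³ × ℝ₋` (this supplies measurability), the
apex bound on `u` and `u_{c_n} → v` in `L³(Q(0, R))` for every `R > 0` exclude every backward
singular point `(0, x)`, `x ≠ 0`, of `v`. [cite: KNSS2009, (1.6)] -/
theorem satHull_noSatellites_of_apexClass
    {u v : ℝ → EuclideanSpace ℝ (Fin 3) → EuclideanSpace ℝ (Fin 3)}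
    {G H : ℝ → EuclideanSpace ℝ (Fin 3) → EuclideanSpace ℝ (Fin 3) →L[ℝ] EuclideanSpace ℝ (Fin 3)}
    {C : ℝ}
    (hwg : HasWeakSpatialGradientOn (slab (EuclideanSpace ℝ (Fin 3)) (Iio 0) isOpen_Iio) u G)
    (hdec : HasTypeIDecay C u) {c : ℕ → ℝ} (hc : ∀ n, 0 < c n)
    (hwg' : HasWeakSpatialGradientOn (slab (EuclideanSpace ℝ (Fin 3)) (Iio 0) isOpen_Iio) v H)
    (hconv : ∀ R : ℝ, 0 < R → Tendsto (fun n => eLpNorm (uncurry (nsRescale (c n) u) - uncurry v) 3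
      (volume.restrict (parabolicCylinder R (0 : ℝ × EuclideanSpace ℝ (Fin 3))))) atTop (𝓝 0))
    {x : EuclideanSpace ℝ (Fin 3)} (hx : x ≠ 0) :
    ¬ IsBackwardSingularPoint v ((0 : ℝ), x) :=
  satHull_noSatellites_of_hasTypeIDecay hdec hwg.locallyIntegrableOn.aestronglyMeasurable hc
    hwg'.locallyIntegrableOn.aestronglyMeasurable hconv hx

/-- **A recurrent singular apex-class profile witnesses S1a** (∃-form of the converse).  If a
uniformly recurrent, origin-singular member `(u, p, G, C)` of the APEX class exists (suitable
weak solution on `ℝ³ × ℝ₋`, weak gradient, `𝐈 < ⊤`, `‖u(t, x)‖ ≤ C/(‖x‖ + √(−t))`), then the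
conclusion of `stub_satHullNoSatellites` holds with the same `(u, p, G, C)`: `u` lies in the rate
class `‖u‖ ≤ C/√(−t)` (`0 ≤ C` is automatic) and its scaling hull is satellite-free
(`satHull_noSatellites_of_apexClass`; the class hypotheses on the hull member `v` other than its
weak gradient are not needed).  Hence the former ∃-form satellite exclusion S1 implies S1a.
[cite: KNSS2009, (1.6)] -/
theorem satHullNoSatellites_of_apexProfile
    (h : ∃ (u : ℝ → EuclideanSpace ℝ (Fin 3) → EuclideanSpace ℝ (Fin 3))
      (p : ℝ → EuclideanSpace ℝ (Fin 3) → ℝ)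
      (G : ℝ → EuclideanSpace ℝ (Fin 3) → EuclideanSpace ℝ (Fin 3) →L[ℝ] EuclideanSpace ℝ (Fin 3)) (C : ℝ),
      IsSuitableWeakSolutionOn (slab (EuclideanSpace ℝ (Fin 3)) (Iio 0) isOpen_Iio) 1 0 u p ∧
      HasWeakSpatialGradientOn (slab (EuclideanSpace ℝ (Fin 3)) (Iio 0) isOpen_Iio) u G ∧
      typeIBound (Iio (0 : ℝ) ×ˢ univ) u p G < ⊤ ∧ HasTypeIDecay C u ∧
      IsScalingUniformlyRecurrent u ∧ IsBackwardSingularPoint u 0) :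
    ∃ (u : ℝ → EuclideanSpace ℝ (Fin 3) → EuclideanSpace ℝ (Fin 3))
      (p : ℝ → EuclideanSpace ℝ (Fin 3) → ℝ)
      (G : ℝ → EuclideanSpace ℝ (Fin 3) → EuclideanSpace ℝ (Fin 3) →L[ℝ] EuclideanSpace ℝ (Fin 3)) (C : ℝ),
      IsSuitableWeakSolutionOn (slab (EuclideanSpace ℝ (Fin 3)) (Iio 0) isOpen_Iio) 1 0 u p ∧
      HasWeakSpatialGradientOn (slab (EuclideanSpace ℝ (Fin 3)) (Iio 0) isOpen_Iio) u G ∧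
      typeIBound (Iio (0 : ℝ) ×ˢ univ) u p G < ⊤ ∧ HasTypeITimeDecay C u ∧
      IsScalingUniformlyRecurrent u ∧ IsBackwardSingularPoint u 0 ∧
      ∀ (c : ℕ → ℝ) (v : ℝ → EuclideanSpace ℝ (Fin 3) → EuclideanSpace ℝ (Fin 3))
        (q : ℝ → EuclideanSpace ℝ (Fin 3) → ℝ)
        (H : ℝ → EuclideanSpace ℝ (Fin 3) → EuclideanSpace ℝ (Fin 3) →L[ℝ] EuclideanSpace ℝ (Fin 3)),
        (∀ n, 0 < c n) →
        IsSuitableWeakSolutionOn (slab (EuclideanSpace ℝ (Fin 3)) (Iio 0) isOpen_Iio) 1 0 v q →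
        HasWeakSpatialGradientOn (slab (EuclideanSpace ℝ (Fin 3)) (Iio 0) isOpen_Iio) v H →
        typeIBound (Iio (0 : ℝ) ×ˢ univ) v q H < ⊤ → HasTypeITimeDecay C v →
        IsBackwardSingularPoint v 0 →
        (∀ R : ℝ, 0 < R → Tendsto (fun n => eLpNorm (uncurry (nsRescale (c n) u) - uncurry v) 3
          (volume.restrict (parabolicCylinder R (0 : ℝ × EuclideanSpace ℝ (Fin 3))))) atTop (𝓝 0)) →
        ∀ x : EuclideanSpace ℝ (Fin 3), x ≠ 0 → ¬ IsBackwardSingularPoint v (0, x) := by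
  obtain ⟨u, p, G, C, hsw, hwg, hI, hdec, hrec, hsing⟩ := h
  -- `0 ≤ C`: evaluate the apex bound at `t = -1`, `x = 0`
  have hC0 : 0 ≤ C := by
    have h1 : (0 : ℝ) ≤ C / (‖(0 : EuclideanSpace ℝ (Fin 3))‖ + Real.sqrt (-(-1 : ℝ))) :=
      (norm_nonneg _).trans (hdec (-1) (by norm_num) 0)
    rw [norm_zero, zero_add, neg_neg, Real.sqrt_one, div_one] at h1
    exact h1
  refine ⟨u, p, G, C, hsw, hwg, hI, hdec.hasTypeITimeDecay hC0, hrec, hsing, ?_⟩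
  intro c v q H hc _ hwg' _ _ _ hconv x hx
  exact satHull_noSatellites_of_apexClass hwg hdec hc hwg' hconv hx

/-! ### Registered tools stub -/

/-- **Registered tools stub `stub_satHullNoSatellitesOfApexTools`** (helper for S1a
`stub_satHullNoSatellites`, `--supports stmt-NavierStokesRegularity-1589`): the conjunction of
the class form (`satHull_noSatellites_of_apexClass`: apex bound on `u` + weak gradients +
`L³_loc` convergence of rescalings ⇒ the limit has no backward singular point `(0, x)`, `x ≠ 0`)
and the ∃-form (`satHullNoSatellites_of_apexProfile`: a recurrent singular apex-class profile
witnesses the conclusion of S1a).  Apex ⟺ satellite-free hull, up to S1b. [cite: KNSS2009, (1.6)] -/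
theorem stub_satHullNoSatellitesOfApexTools :
    (∀ (u : ℝ → EuclideanSpace ℝ (Fin 3) → EuclideanSpace ℝ (Fin 3))
      (G : ℝ → EuclideanSpace ℝ (Fin 3) → EuclideanSpace ℝ (Fin 3) →L[ℝ] EuclideanSpace ℝ (Fin 3)) (C : ℝ),
      HasWeakSpatialGradientOn (slab (EuclideanSpace ℝ (Fin 3)) (Iio 0) isOpen_Iio) u G →
      HasTypeIDecay C u →
      ∀ (c : ℕ → ℝ) (v : ℝ → EuclideanSpace ℝ (Fin 3) → EuclideanSpace ℝ (Fin 3))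
        (H : ℝ → EuclideanSpace ℝ (Fin 3) → EuclideanSpace ℝ (Fin 3) →L[ℝ] EuclideanSpace ℝ (Fin 3)),
        (∀ n, 0 < c n) →
        HasWeakSpatialGradientOn (slab (EuclideanSpace ℝ (Fin 3)) (Iio 0) isOpen_Iio) v H →
        (∀ R : ℝ, 0 < R → Tendsto (fun n => eLpNorm (uncurry (nsRescale (c n) u) - uncurry v) 3
          (volume.restrict (parabolicCylinder R (0 : ℝ × EuclideanSpace ℝ (Fin 3))))) atTop (𝓝 0)) →
        ∀ x : EuclideanSpace ℝ (Fin 3), x ≠ 0 → ¬ IsBackwardSingularPoint v (0, x)) ∧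
    ((∃ (u : ℝ → EuclideanSpace ℝ (Fin 3) → EuclideanSpace ℝ (Fin 3))
      (p : ℝ → EuclideanSpace ℝ (Fin 3) → ℝ)
      (G : ℝ → EuclideanSpace ℝ (Fin 3) → EuclideanSpace ℝ (Fin 3) →L[ℝ] EuclideanSpace ℝ (Fin 3)) (C : ℝ),
      IsSuitableWeakSolutionOn (slab (EuclideanSpace ℝ (Fin 3)) (Iio 0) isOpen_Iio) 1 0 u p ∧
      HasWeakSpatialGradientOn (slab (EuclideanSpace ℝ (Fin 3)) (Iio 0) isOpen_Iio) u G ∧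
      typeIBound (Iio (0 : ℝ) ×ˢ univ) u p G < ⊤ ∧ HasTypeIDecay C u ∧
      IsScalingUniformlyRecurrent u ∧ IsBackwardSingularPoint u 0) →
    ∃ (u : ℝ → EuclideanSpace ℝ (Fin 3) → EuclideanSpace ℝ (Fin 3))
      (p : ℝ → EuclideanSpace ℝ (Fin 3) → ℝ)
      (G : ℝ → EuclideanSpace ℝ (Fin 3) → EuclideanSpace ℝ (Fin 3) →L[ℝ] EuclideanSpace ℝ (Fin 3)) (C : ℝ),
      IsSuitableWeakSolutionOn (slab (EuclideanSpace ℝ (Fin 3)) (Iio 0) isOpen_Iio) 1 0 u p ∧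
      HasWeakSpatialGradientOn (slab (EuclideanSpace ℝ (Fin 3)) (Iio 0) isOpen_Iio) u G ∧
      typeIBound (Iio (0 : ℝ) ×ˢ univ) u p G < ⊤ ∧ HasTypeITimeDecay C u ∧
      IsScalingUniformlyRecurrent u ∧ IsBackwardSingularPoint u 0 ∧
      ∀ (c : ℕ → ℝ) (v : ℝ → EuclideanSpace ℝ (Fin 3) → EuclideanSpace ℝ (Fin 3))
        (q : ℝ → EuclideanSpace ℝ (Fin 3) → ℝ)
        (H : ℝ → EuclideanSpace ℝ (Fin 3) → EuclideanSpace ℝ (Fin 3) →L[ℝ] EuclideanSpace ℝ (Fin 3)),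
        (∀ n, 0 < c n) →
        IsSuitableWeakSolutionOn (slab (EuclideanSpace ℝ (Fin 3)) (Iio 0) isOpen_Iio) 1 0 v q →
        HasWeakSpatialGradientOn (slab (EuclideanSpace ℝ (Fin 3)) (Iio 0) isOpen_Iio) v H →
        typeIBound (Iio (0 : ℝ) ×ˢ univ) v q H < ⊤ → HasTypeITimeDecay C v →
        IsBackwardSingularPoint v 0 →
        (∀ R : ℝ, 0 < R → Tendsto (fun n => eLpNorm (uncurry (nsRescale (c n) u) - uncurry v) 3
          (volume.restrict (parabolicCylinder R (0 : ℝ × EuclideanSpace ℝ (Fin 3))))) atTop (𝓝 0)) →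
        ∀ x : EuclideanSpace ℝ (Fin 3), x ≠ 0 → ¬ IsBackwardSingularPoint v (0, x)) :=
  ⟨fun _ _ _ hwg hdec _ _ _ hc hwg' hconv _ hx =>
      satHull_noSatellites_of_apexClass hwg hdec hc hwg' hconv hx,
    satHullNoSatellites_of_apexProfile⟩

end Summit.NavierStokesRegularity.NavierStokesRegularity.Theorems

end
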